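import Mathlib
import Summits.MatrixMultiplication.MatrixMultiplication.Theorems.HiddenToeplitzCornersHiddenCornerLemmaRPhiInjGeneral

/-!
# Reduction of the G-const dual law to the nonexistence of nonsingular `(2p+1)`-column designs
# (hidden-corner lemma, crux stmt-MatrixMultiplication-10752)

Support file for crux item `stmt-MatrixMultiplication-10752`
(`Summit.MatrixMultiplication.MatrixMultiplication.Theses.HiddenToeplitzCorners.HiddenCornerLemmaR`),
line `atkinson-lloyd-core-split`, stub `hclR_gconstDualLaw_of_noDesign`: for every `p`, the G-const
dual law `stub_gconstDualLaw` (conclusion `r ≤ 2 * p`) follows from the nonexistence of nonsingular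
`(2p+1)`-column designs of the `p`-generator class — "for every `(2p+1)`-column instance
`(E, F, M, H, X₀)` of the G-const dual-law data (`rank E = rank F = 2p+1`, the annihilator hypothesis,
`M - Z M Zᵀ = G₀ Hᵀ`, `M E = F X₀`, `det M ≠ 0`) one has `False`".

`Z` is the lower shift on `Fin N → ℂ` written verbatim as in the crux (`Z i j = [i = j + 1]`).

Proof (the template `hclR_gconstDualLaw_of_phiInj`, module `…PhiInjGeneral`, without the PHI-INJ
step).  Suppose `2p < r`, i.e. `2p + 1 ≤ r`, and let `ι : Fin (2p+1) → Fin r` be the (injective)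
initial-segment embedding `Fin.castLE`.  The columns of `E` are linearly independent
(`rank E = r`), so the sub-frame `E' := E.submatrix id ι` has rank `2p+1`, and so does
`F' := M * E'` (`Matrix.rank_mul_eq_right_of_isUnit_det`, `det M ≠ 0`).  The sub-instance
`(E', F', M, H, 1)` inherits the annihilator hypothesis: a `(2p+1)`-column test matrix `Λ'`
annihilated on `E'` extends by zero along `ι` to an `r`-column test matrix annihilated on `E`
(`hclR_phi_sum_extend_fin`), whence `Λᵀ F = 0`, so `Λ'ᵀ F = 0` and
`Λ'ᵀ F' = Λ'ᵀ M E' = Λ'ᵀ F (X₀.submatrix id ι) = 0` (`M E = F X₀`).  The hypothesis applied to the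
sub-instance gives `False`.

* `hclR_nd_rank_submatrix` — a column sub-family of a full-column-rank matrix has full column rank;
* `hclR_nd_ann_descends` — the annihilator hypothesis descends to the sub-instance on the columns `ι`;
* `hclR_gconstDualLaw_of_noDesign` — the registered statement.
-/

set_option linter.dupNamespace false

namespace Summit.MatrixMultiplication.MatrixMultiplication.Theorems

open Matrix BigOperators Finset

/-- A column sub-family `E.submatrix id ι` (`ι : Fin m → Fin r` injective) of a matrix
`E : N × r` of full column rank `r` has full column rank `m`. -/
theorem hclR_nd_rank_submatrix {N r m : ℕ} (E : Matrix (Fin N) (Fin r) ℂ) (hE : E.rank = r)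
    (ι : Fin m → Fin r) (hι : Function.Injective ι) : (E.submatrix id ι).rank = m := by
  have hcols : LinearIndependent ℂ E.col := by
    rw [linearIndependent_iff_card_eq_finrank_span, Fintype.card_fin, Set.finrank,
      ← Matrix.rank_eq_finrank_span_cols, hE]
  have hli : LinearIndependent ℂ (E.submatrix id ι).col := hcols.comp ι hι
  have h := linearIndependent_iff_card_eq_finrank_span.mp hli
  rw [Fintype.card_fin, Set.finrank, ← Matrix.rank_eq_finrank_span_cols] at h
  exact h.symm

/-- The annihilator hypothesis descends to the sub-instance on the columns `ι : Fin m → Fin r`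
(`ι` injective) of a design `M E = F X₀`: if every `r`-column test matrix annihilated on the frame
`E` kills `F`, then every `m`-column test matrix annihilated on the sub-frame `E.submatrix id ι`
kills `M * E.submatrix id ι` (extend the test matrix by zero along `ι`, `hclR_phi_sum_extend_fin`). -/
theorem hclR_nd_ann_descends {N r m p : ℕ} (ι : Fin m → Fin r) (hι : Function.Injective ι)
    (G₀ : Matrix (Fin N) (Fin p) ℂ) (E F : Matrix (Fin N) (Fin r) ℂ) (M : Matrix (Fin N) (Fin N) ℂ)
    (X₀ : Matrix (Fin r) (Fin r) ℂ)
    (hann : ∀ Λ : Matrix (Fin N) (Fin r) ℂ,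
      (∀ k : Fin p,
        (∑ c : Fin r,
          (∑ j : Fin N,
            (((∑ i : Fin N, G₀ i k •
                (Matrix.of fun i j : Fin N => if (i : ℕ) = (j : ℕ) + 1 then (1 : ℂ) else 0)ᵀ ^ (i : ℕ))
              *ᵥ (Λᵀ c)) j) •
            (Matrix.of fun i j : Fin N => if (i : ℕ) = (j : ℕ) + 1 then (1 : ℂ) else 0)ᵀ ^ (j : ℕ))
          *ᵥ (Eᵀ c)) = 0) →
      Λᵀ * F = 0)
    (hME : M * E = F * X₀) :
    ∀ Λ : Matrix (Fin N) (Fin m) ℂ,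
      (∀ k : Fin p,
        (∑ c : Fin m,
          (∑ j : Fin N,
            (((∑ i : Fin N, G₀ i k •
                (Matrix.of fun i j : Fin N => if (i : ℕ) = (j : ℕ) + 1 then (1 : ℂ) else 0)ᵀ ^ (i : ℕ))
              *ᵥ (Λᵀ c)) j) •
            (Matrix.of fun i j : Fin N => if (i : ℕ) = (j : ℕ) + 1 then (1 : ℂ) else 0)ᵀ ^ (j : ℕ))
          *ᵥ ((E.submatrix id ι)ᵀ c)) = 0) →
      Λᵀ * (M * E.submatrix id ι) = 0 := by
  intro Λ hΛ
  -- `M` maps the sub-frame into the span of `F`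
  have hFmX : M * E.submatrix id ι = F * X₀.submatrix id ι := by
    ext n i
    have h := congrFun (congrFun hME n) (ι i)
    simpa only [Matrix.mul_apply, Matrix.submatrix_apply, id] using h
  -- the test matrix `Λ` extended by zero along `ι` is annihilated on `E`, hence kills `F`
  have hΛF : (Matrix.of fun (n : Fin N) (c : Fin r) =>
      ∑ i : Fin m, if ι i = c then Λ n i else 0)ᵀ * F = 0 := by
    apply hann
    intro k
    rw [hclR_phi_sum_extend_fin]
    exact hΛ k
  have hΛF' : Λᵀ * F = 0 := by
    ext i a
    have h := congrFun (congrFun hΛF (ι i)) a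
    simpa [Matrix.mul_apply, hι.eq_iff] using h
  rw [hFmX, ← Matrix.mul_assoc, hΛF', Matrix.zero_mul]

/-- **Reduction of the G-const dual law to the nonexistence of nonsingular `(2p+1)`-column designs.**
If no `(2p+1)`-column instance `(E, F, M, H, X₀)` of the G-const dual-law data exists
(`rank E = rank F = 2p+1`, the annihilator hypothesis, `M - Z M Zᵀ = G₀ Hᵀ`, `M E = F X₀`,
`det M ≠ 0` imply `False`), then the registered `stub_gconstDualLaw` holds (`r ≤ 2p`): an
`r`-column instance with `2p < r` restricts to its first `2p+1` columns
(`hclR_nd_rank_submatrix`, `Matrix.rank_mul_eq_right_of_isUnit_det`, `hclR_nd_ann_descends`). -/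
theorem hclR_gconstDualLaw_of_noDesign :
    (∀ (N p : ℕ) (G₀ : Matrix (Fin N) (Fin p) ℂ) (E F : Matrix (Fin N) (Fin (2 * p + 1)) ℂ)
      (M : Matrix (Fin N) (Fin N) ℂ) (H : Matrix (Fin N) (Fin p) ℂ)
      (X₀ : Matrix (Fin (2 * p + 1)) (Fin (2 * p + 1)) ℂ),
      E.rank = 2 * p + 1 → F.rank = 2 * p + 1 →
      (∀ Λ : Matrix (Fin N) (Fin (2 * p + 1)) ℂ,
        (∀ k : Fin p,
          (∑ c : Fin (2 * p + 1),
            (∑ j : Fin N,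
              (((∑ i : Fin N, G₀ i k •
                  (Matrix.of fun i j : Fin N => if (i : ℕ) = (j : ℕ) + 1 then (1 : ℂ) else 0)ᵀ ^ (i : ℕ))
                *ᵥ (Λᵀ c)) j) •
              (Matrix.of fun i j : Fin N => if (i : ℕ) = (j : ℕ) + 1 then (1 : ℂ) else 0)ᵀ ^ (j : ℕ))
            *ᵥ (Eᵀ c)) = 0) →
        Λᵀ * F = 0) →
      M - (Matrix.of fun i j : Fin N => if (i : ℕ) = (j : ℕ) + 1 then (1 : ℂ) else 0) * M *
          (Matrix.of fun i j : Fin N => if (i : ℕ) = (j : ℕ) + 1 then (1 : ℂ) else 0)ᵀ = G₀ * Hᵀ →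
      M * E = F * X₀ → M.det ≠ 0 → False) →
    ∀ (r N p : ℕ) (G₀ : Matrix (Fin N) (Fin p) ℂ) (E F : Matrix (Fin N) (Fin r) ℂ)
      (M : Matrix (Fin N) (Fin N) ℂ) (H : Matrix (Fin N) (Fin p) ℂ) (X₀ : Matrix (Fin r) (Fin r) ℂ),
      E.rank = r → F.rank = r →
      (∀ Λ : Matrix (Fin N) (Fin r) ℂ,
        (∀ k : Fin p,
          (∑ c : Fin r,
            (∑ j : Fin N,
              (((∑ i : Fin N, G₀ i k •
                  (Matrix.of fun i j : Fin N => if (i : ℕ) = (j : ℕ) + 1 then (1 : ℂ) else 0)ᵀ ^ (i : ℕ))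
                *ᵥ (Λᵀ c)) j) •
              (Matrix.of fun i j : Fin N => if (i : ℕ) = (j : ℕ) + 1 then (1 : ℂ) else 0)ᵀ ^ (j : ℕ))
            *ᵥ (Eᵀ c)) = 0) →
        Λᵀ * F = 0) →
      M - (Matrix.of fun i j : Fin N => if (i : ℕ) = (j : ℕ) + 1 then (1 : ℂ) else 0) * M *
          (Matrix.of fun i j : Fin N => if (i : ℕ) = (j : ℕ) + 1 then (1 : ℂ) else 0)ᵀ = G₀ * Hᵀ →
      M * E = F * X₀ →
      M.det ≠ 0 →
      r ≤ 2 * p := by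
  intro hno r N p G₀ E F M H X₀ hE _hF hann hM hME hdet
  by_contra hr
  -- `2p + 1 ≤ r`: restrict the instance to its first `2p + 1` columns
  have hle : 2 * p + 1 ≤ r := by omega
  have hι : Function.Injective (Fin.castLE hle) := Fin.castLE_injective hle
  -- (i) the sub-frame has rank `2p + 1`, (ii) so does its image under the invertible `M`
  have hEm : (E.submatrix id (Fin.castLE hle)).rank = 2 * p + 1 :=
    hclR_nd_rank_submatrix E hE (Fin.castLE hle) hι
  have hFm : (M * E.submatrix id (Fin.castLE hle)).rank = 2 * p + 1 := by
    rw [Matrix.rank_mul_eq_right_of_isUnit_det M _ (isUnit_iff_ne_zero.mpr hdet), hEm]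
  -- (iii) the annihilator hypothesis descends; the sub-instance is a nonsingular `(2p+1)`-design
  exact hno N p G₀ (E.submatrix id (Fin.castLE hle)) (M * E.submatrix id (Fin.castLE hle)) M H 1
    hEm hFm (hclR_nd_ann_descends (Fin.castLE hle) hι G₀ E F M X₀ hann hME) hM
    (Matrix.mul_one _).symm hdet

end Summit.MatrixMultiplication.MatrixMultiplication.Theorems
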